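import Mathlib
import Summits.Ventures.HodgeRepro.Tier4.Line1.RTFSetting
import Summits.Ventures.HodgeRepro.Tier4.Line1.RtfUnfold

/-!
# Tier4/Line1/RtfSpectralStep — LINE L1, L1.2b `rtf_spectral` modulo L1.2a: Bessel + dominated convergence

Blind re-derivation cell `pub-hodge-repro`, Tier 4 «prove the step» (README §9–§10), seat t4-L1-p4 (prover, gen 0; lead
S12132 / S12152: t4-L1-p4 = L1.2b).  Module 2 of 2 for L1.2b; module 1 = `Tier4/Line1/RtfUnfold.lean`.
Paper proof: proofs/t4/L1/L1.2b.md (Steps 3–4 here).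

THE LEMMA (Skeleton v0.8 12c8528bc811170c L434–L439 = v0.9 a06d5c6d2f1bfa47, VERBATIM):
```
theorem rtf_spectral {χ : S.T → ℂ} {χ' : S.T' → ℂ} (hχ : S.IsCharacter χ) (hχ' : S.IsCharacter' χ')
    {τ : ℕ → Set (G → ℂ)} {φ : ℕ → G → ℂ} {n : ℕ → ℕ} (hB : S.IsAdaptedONB τ φ n)
    {f₁ f₂ : G → ℂ} (h₁ : IsTest f₁) (h₂ : IsTest f₂) :
    HasSum (fun j => S.periodT' χ' (fun t' => S.R (refl f₂) (φ j) t') *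
        starRingEnd ℂ (S.periodT χ (fun t => S.R (cj f₁) (φ j) t)))
      (S.J χ χ' (S.conv f₁ f₂))
```
L1.2b is «integrate L1.2a over `DT × DT′`» (the skeleton's cut).  L1.2a = `kernel_spectral` (t4-L1-p3, S12239) is the
POINTWISE expansion `∀ x y, HasSum (fun j => R(f₂ˇ)φ_j(y) · conj(R(f̄₁)φ_j(x))) (K_{f₁⋆f₂}(x, y))`.  This module proves the
INTEGRATION STEP with that expansion as a DISPLAYED hypothesis `hK` (`rtf_spectral_of_kernel_spectral`); `rtf_spectral`
itself is the one-line composition `rtf_spectral_of_kernel_spectral hχ hχ' hB h₁ h₂ (S.kernel_spectral hB h₁ h₂)` the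
moment L1.2a lands (`Tier4/Line1/RtfSpectral.lean`); L1.2a is NOT assumed, restated or proved here.

* Step 3 — BESSEL in `L²(DG, μ)` (`bessel_finset`: Mathlib's `Orthonormal.sum_inner_products_le` transported along
  `MemLp.toLp`; `⟪u, v⟫_{L²} = S.inner v u`), hence the UNIFORM BOUND `∑_j ‖R(f)φ_j(y)‖² ≤ M(C₁)` for every `y` in a
  compact `C₁` (`exists_bound_sum_sq_norm_R`, via the finite unfolding of `RtfUnfold`: `R(f)φ_j(y) = ∫_{DG} k_y φ_j`
  with `‖k_y‖ ≤ |Γ| sup ‖f‖`) and pointwise summability (`summable_sq_norm_R`).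
* Step 4 — the ASSEMBLY (`rtf_spectral_of_kernel_spectral`): on `ν = (μT|DT) ⊗ (μT′|DT′)` (finite: `DT`, `DT′` have
  compact closures), the term `j` of the statement is `∫ v_j(t) u_j(t′) dν` (`integral_prod_mul`, `integral_conj`),
  `J(f₁⋆f₂) = ∫ H dν` (Fubini `integral_prod`), `∑_j v_j u_j = H` pointwise (`hK` times the characters), and
  `MeasureTheory.hasSum_integral_of_dominated_convergence` with the bound `½(‖R(f₂ˇ)φ_j(t′)‖² + ‖R(f̄₁)φ_j(t)‖²)`
  (`2ab ≤ a² + b²`, `|χ| = |χ′| = 1`), summable everywhere and `≤ ½(M₂ + M₁)` a.e. on `DT × DT′` by Step 3.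

Fields of `hB` used: `mem`, `inv`, `orth` — never `complete`, `irred`, `orthSub`.  Setting fields used: `haar`, `haarT`,
`haarT'`, `fdG`, `fdT`, `fdT'`, `compG`, `compT`, `compT'`, `discrete`, `closed`.
`#print axioms rtf_spectral_of_kernel_spectral` = [propext, Classical.choice, Quot.sound].

Nothing here says anything about the status of the Hodge conjecture for CM abelian varieties, which is NOT proved;
HC_CM is NOT proved by anyone in this repository.
-/

set_option autoImplicit false

noncomputable section

namespace Summit.Ventures.HodgeRepro.Tier4.Line1

open MeasureTheory Topology Filter Set
open scoped Uniformity Pointwise InnerProductSpace ComplexConjugate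

namespace RTF

variable {G : Type} [Group G] [TopologicalSpace G] [IsTopologicalGroup G] [MeasurableSpace G]
  [BorelSpace G]

namespace Setting

variable (S : Setting G)

/-! ### Step 3 — Bessel's inequality in `L²(DG)` and the uniform coefficient bound -/

omit [IsTopologicalGroup G] [BorelSpace G] in
/-- `DG` carries a finite measure. -/
theorem isFiniteMeasure_DG : IsFiniteMeasure (S.μ.restrict S.DG) :=
  isFiniteMeasure_restrict.mpr S.measure_DG_ne_top

omit [IsTopologicalGroup G] in
/-- a continuous function lies in `L²(DG, μ)`. -/
theorem memLp_two_DG {ψ : G → ℂ} (hψ : Continuous ψ) : MemLp ψ 2 (S.μ.restrict S.DG) := by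
  haveI := S.isFiniteMeasure_DG
  obtain ⟨C, -, hC⟩ := S.exists_bound_closure hψ
  refine MemLp.of_bound hψ.aestronglyMeasurable C ?_
  filter_upwards [ae_restrict_mem₀ S.fdG.nullMeasurableSet] with x hx
  exact hC x (subset_closure hx)

omit [IsTopologicalGroup G] [BorelSpace G] in
/-- the `L²(DG)` inner product of Mathlib is `S.inner` with the arguments swapped
(`⟪u, v⟫ = ∫ v · conj u`). -/
theorem L2_inner_eq {u v : G → ℂ} (hu : MemLp u 2 (S.μ.restrict S.DG))
    (hv : MemLp v 2 (S.μ.restrict S.DG)) : ⟪hu.toLp u, hv.toLp v⟫_ℂ = S.inner v u := by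
  rw [L2.inner_def]
  unfold inner
  apply integral_congr_ae
  filter_upwards [hu.coeFn_toLp, hv.coeFn_toLp] with a hua hva
  rw [hua, hva, RCLike.inner_apply]

omit [IsTopologicalGroup G] in
/-- BESSEL'S INEQUALITY in `L²(DG, μ)`: for a family of continuous functions orthonormal for `S.inner`
and any `w ∈ L²(DG)`, `∑_{j ∈ s} ‖S.inner w (φ j)‖² ≤ ∫_{DG} ‖w‖²` (Mathlib's
`Orthonormal.sum_inner_products_le` transported along `MemLp.toLp`). -/
theorem bessel_finset {φ : ℕ → G → ℂ} (hφc : ∀ j, Continuous (φ j))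
    (horth : ∀ j j', S.inner (φ j) (φ j') = if j = j' then 1 else 0)
    {w : G → ℂ} (hw : MemLp w 2 (S.μ.restrict S.DG)) (s : Finset ℕ) :
    ∑ j ∈ s, ‖S.inner w (φ j)‖ ^ 2 ≤ ∫ x in S.DG, ‖w x‖ ^ 2 ∂S.μ := by
  haveI := S.isFiniteMeasure_DG
  let Φ : ℕ → Lp ℂ 2 (S.μ.restrict S.DG) := fun j => (S.memLp_two_DG (hφc j)).toLp (φ j)
  let W : Lp ℂ 2 (S.μ.restrict S.DG) := hw.toLp w
  have hΦ : Orthonormal ℂ Φ := by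
    rw [orthonormal_iff_ite]
    intro i j
    show ⟪(S.memLp_two_DG (hφc i)).toLp (φ i), (S.memLp_two_DG (hφc j)).toLp (φ j)⟫_ℂ = _
    rw [S.L2_inner_eq, horth]
    by_cases h : i = j
    · simp [h]
    · simp [h, Ne.symm h]
  have hb := hΦ.sum_inner_products_le W (s := s)
  have hl : ∀ j, ‖⟪Φ j, W⟫_ℂ‖ = ‖S.inner w (φ j)‖ := fun j => by
    show ‖⟪(S.memLp_two_DG (hφc j)).toLp (φ j), hw.toLp w⟫_ℂ‖ = _
    rw [S.L2_inner_eq]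
  have hr : ‖W‖ ^ 2 = ∫ x in S.DG, ‖w x‖ ^ 2 ∂S.μ := by
    rw [norm_sq_eq_re_inner (𝕜 := ℂ) W, L2.inner_def, ← integral_re (L2.integrable_inner W W)]
    apply integral_congr_ae
    filter_upwards [hw.coeFn_toLp] with a ha
    rw [inner_self_eq_norm_sq, ha]
  calc ∑ j ∈ s, ‖S.inner w (φ j)‖ ^ 2 = ∑ j ∈ s, ‖⟪Φ j, W⟫_ℂ‖ ^ 2 := by simp_rw [hl]
    _ ≤ ‖W‖ ^ 2 := hb
    _ = _ := hr

/-- THE UNIFORM COEFFICIENT BOUND.  For a test function `f`, an adapted orthonormal family and a compact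
`C₁`: there is `M` with `∑_{j ∈ s} ‖R(f)φ_j(y)‖² ≤ M` for every finite `s` and every `y ∈ C₁` — the
finite unfolding writes `R(f)φ_j(y) = ∫_{DG} k_y φ_j` with `‖k_y‖ ≤ |Γ| · sup ‖f‖`, and Bessel's inequality
for the orthonormal `φ_j` bounds the sum by `‖k_y‖²_{L²(DG)} ≤ μ(DG) (|Γ| sup ‖f‖)²`. -/
theorem exists_bound_sum_sq_norm_R {f : G → ℂ} (hf : IsTest f) {τ : ℕ → Set (G → ℂ)}
    {φ : ℕ → G → ℂ} {n : ℕ → ℕ} (hB : S.IsAdaptedONB τ φ n) {C₁ : Set G} (hC₁ : IsCompact C₁) :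
    ∃ M : ℝ, 0 ≤ M ∧ ∀ y ∈ C₁, ∀ s : Finset ℕ, ∑ j ∈ s, ‖S.R f (φ j) y‖ ^ 2 ≤ M := by
  haveI := S.haar
  haveI := S.isFiniteMeasure_DG
  have hfin := S.finite_rational_inter (S.isCompact_window hf hC₁)
  set Γ : Finset S.Gk := hfin.toFinset with hΓdef
  have hΓ : ∀ γ : S.Gk, (γ : G) ∈ C₁ * tsupport f * (closure S.DG)⁻¹ → γ ∈ Γ :=
    fun γ h => hfin.mem_toFinset.mpr h
  obtain ⟨Mf, hMf⟩ := hf.cont.bounded_above_of_compact_support hf.compact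
  have hMf0 : 0 ≤ Mf := (norm_nonneg _).trans (hMf 1)
  refine ⟨S.μ.real S.DG * ((Γ.card : ℝ) * Mf) ^ 2, by positivity, ?_⟩
  intro y hy s
  have hφc : ∀ j, Continuous (φ j) := fun j => (hB.inv (n j)).cont _ (hB.mem j)
  have hφinv : ∀ j, S.Invariant (φ j) := fun j => (hB.inv (n j)).inv _ (hB.mem j)
  -- the finite kernel `k` and its conjugate `w`
  set k : G → ℂ := fun z => ∑ γ ∈ Γ, f (y⁻¹ * γ * z) with hk
  have hkc : Continuous k :=
    continuous_finsetSum _ fun γ _ => hf.cont.comp (continuous_const.mul continuous_id)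
  have hkb : ∀ z, ‖k z‖ ≤ (Γ.card : ℝ) * Mf := fun z => by
    calc ‖∑ γ ∈ Γ, f (y⁻¹ * γ * z)‖ ≤ ∑ γ ∈ Γ, ‖f (y⁻¹ * γ * z)‖ := norm_sum_le _ _
      _ ≤ ∑ _γ ∈ Γ, Mf := Finset.sum_le_sum fun γ _ => hMf _
      _ = (Γ.card : ℝ) * Mf := by rw [Finset.sum_const, nsmul_eq_mul]
  set w : G → ℂ := fun z => conj (k z) with hw
  have hwc : Continuous w := Complex.continuous_conj.comp hkc
  have hwL : MemLp w 2 (S.μ.restrict S.DG) := S.memLp_two_DG hwc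
  -- the coefficients
  have hcoef : ∀ j, S.inner w (φ j) = conj (S.R f (φ j) y) := by
    intro j
    rw [S.R_eq_setIntegral_finiteKernel hf (hφinv j) (hφc j) Γ hΓ hy]
    unfold inner
    rw [← integral_conj]
    congr 1
    ext z
    simp only [hw, hk, map_mul]
  have hbes := S.bessel_finset hφc hB.orth hwL s
  calc ∑ j ∈ s, ‖S.R f (φ j) y‖ ^ 2 = ∑ j ∈ s, ‖S.inner w (φ j)‖ ^ 2 := by
        simp_rw [hcoef, RCLike.norm_conj]
    _ ≤ ∫ x in S.DG, ‖w x‖ ^ 2 ∂S.μ := hbes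
    _ ≤ ∫ _x in S.DG, ((Γ.card : ℝ) * Mf) ^ 2 ∂S.μ := by
        apply integral_mono_of_nonneg (Eventually.of_forall fun x => by positivity)
          (integrable_const _)
        refine Eventually.of_forall fun x => ?_
        show ‖w x‖ ^ 2 ≤ ((Γ.card : ℝ) * Mf) ^ 2
        have : ‖w x‖ = ‖k x‖ := RCLike.norm_conj _
        rw [this]
        exact pow_le_pow_left₀ (norm_nonneg _) (hkb x) 2
    _ = S.μ.real S.DG * ((Γ.card : ℝ) * Mf) ^ 2 := by rw [setIntegral_const, smul_eq_mul]

/-- pointwise: the coefficient series `∑_j ‖R(f)φ_j(y)‖²` is summable (Bessel at the compact `{y}`). -/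
theorem summable_sq_norm_R {f : G → ℂ} (hf : IsTest f) {τ : ℕ → Set (G → ℂ)}
    {φ : ℕ → G → ℂ} {n : ℕ → ℕ} (hB : S.IsAdaptedONB τ φ n) (y : G) :
    Summable fun j => ‖S.R f (φ j) y‖ ^ 2 := by
  obtain ⟨M, -, hM⟩ := S.exists_bound_sum_sq_norm_R hf hB (isCompact_singleton (x := y))
  exact summable_of_sum_le (fun j => by positivity) (hM y (Set.mem_singleton y))

/-- uniform: `∑' j, ‖R(f)φ_j(y)‖² ≤ M` for all `y ∈ C₁`. -/
theorem exists_bound_tsum_sq_norm_R {f : G → ℂ} (hf : IsTest f) {τ : ℕ → Set (G → ℂ)}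
    {φ : ℕ → G → ℂ} {n : ℕ → ℕ} (hB : S.IsAdaptedONB τ φ n) {C₁ : Set G} (hC₁ : IsCompact C₁) :
    ∃ M : ℝ, 0 ≤ M ∧ ∀ y ∈ C₁, ∑' j, ‖S.R f (φ j) y‖ ^ 2 ≤ M := by
  obtain ⟨M, hM0, hM⟩ := S.exists_bound_sum_sq_norm_R hf hB hC₁
  exact ⟨M, hM0, fun y hy => Real.tsum_le_of_sum_le (fun j => by positivity) (hM y hy)⟩

/-! ### Step 4 — the assembly (dominated convergence on `DT × DT'`) -/

omit [IsTopologicalGroup G] [BorelSpace G] in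
/-- `DT` has finite `μT`-measure (`closure DT` is compact). -/
theorem measure_DT_ne_top : S.μT S.DT ≠ ⊤ := by
  haveI := S.haarT
  exact ne_top_of_le_ne_top S.compT.measure_lt_top.ne (measure_mono subset_closure)

omit [IsTopologicalGroup G] [BorelSpace G] in
/-- `DT'` has finite `μT'`-measure (`closure DT'` is compact). -/
theorem measure_DT'_ne_top : S.μT' S.DT' ≠ ⊤ := by
  haveI := S.haarT'
  exact ne_top_of_le_ne_top S.compT'.measure_lt_top.ne (measure_mono subset_closure)

omit [IsTopologicalGroup G] [BorelSpace G] in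
/-- the image of `closure DT` in `G` is compact. -/
theorem isCompact_image_closure_DT : IsCompact ((fun t : S.T => (t : G)) '' closure S.DT) :=
  S.compT.image continuous_subtype_val

omit [IsTopologicalGroup G] [BorelSpace G] in
/-- the image of `closure DT'` in `G` is compact. -/
theorem isCompact_image_closure_DT' : IsCompact ((fun t : S.T' => (t : G)) '' closure S.DT') :=
  S.compT'.image continuous_subtype_val

/-- L1.2b WITH THE POINTWISE EXPANSION AS A HYPOTHESIS: given L1.2a's kernel expansion `hK` at every
`(x, y)`, the spectral expansion of `J(f₁ ⋆ f₂)` follows by dominated convergence on `DT × DT'`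
(product of the finite restricted measures), the terms being dominated by
`(‖R(f₂ˇ)φ_j(t')‖² + ‖R(f̄₁)φ_j(t)‖²)/2`, whose sum over `j` is bounded on `DT × DT'` by Bessel's
inequality (`exists_bound_tsum_sq_norm_R`). -/
theorem rtf_spectral_of_kernel_spectral {χ : S.T → ℂ} {χ' : S.T' → ℂ} (hχ : S.IsCharacter χ)
    (hχ' : S.IsCharacter' χ') {τ : ℕ → Set (G → ℂ)} {φ : ℕ → G → ℂ} {n : ℕ → ℕ}
    (hB : S.IsAdaptedONB τ φ n) {f₁ f₂ : G → ℂ} (h₁ : IsTest f₁) (h₂ : IsTest f₂)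
    (hK : ∀ x y : G, HasSum (fun j => S.R (refl f₂) (φ j) y * starRingEnd ℂ (S.R (cj f₁) (φ j) x))
      (S.kernel (S.conv f₁ f₂) x y)) :
    HasSum (fun j => S.periodT' χ' (fun t' => S.R (refl f₂) (φ j) t') *
        starRingEnd ℂ (S.periodT χ (fun t => S.R (cj f₁) (φ j) t)))
      (S.J χ χ' (S.conv f₁ f₂)) := by
  haveI := S.haarT
  haveI := S.haarT'
  -- the finite measures on `DT`, `DT'` and their product
  haveI hνT : IsFiniteMeasure (S.μT.restrict S.DT) := isFiniteMeasure_restrict.mpr S.measure_DT_ne_top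
  haveI hνT' : IsFiniteMeasure (S.μT'.restrict S.DT') :=
    isFiniteMeasure_restrict.mpr S.measure_DT'_ne_top
  set ν : Measure (S.T × S.T') := (S.μT.restrict S.DT).prod (S.μT'.restrict S.DT') with hν
  -- the coefficient functions on `G`
  have hφc : ∀ j, Continuous (φ j) := fun j => (hB.inv (n j)).cont _ (hB.mem j)
  have hφinv : ∀ j, S.Invariant (φ j) := fun j => (hB.inv (n j)).inv _ (hB.mem j)
  have hac : ∀ j, Continuous (S.R (cj f₁) (φ j)) := fun j => by
    obtain ⟨B, -, hBφ⟩ := S.exists_bound_of_invariant (hφinv j) (hφc j)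
    exact S.continuous_R h₁.cj (hφc j) hBφ
  have ha'c : ∀ j, Continuous (S.R (refl f₂) (φ j)) := fun j => by
    obtain ⟨B, -, hBφ⟩ := S.exists_bound_of_invariant (hφinv j) (hφc j)
    exact S.continuous_R h₂.refl (hφc j) hBφ
  have hab : ∀ j, ∃ C : ℝ, ∀ x, ‖S.R (cj f₁) (φ j) x‖ ≤ C := fun j => by
    obtain ⟨B, -, hBφ⟩ := S.exists_bound_of_invariant (hφinv j) (hφc j)
    exact ⟨_, S.norm_R_le h₁.cj hBφ⟩
  have ha'b : ∀ j, ∃ C : ℝ, ∀ x, ‖S.R (refl f₂) (φ j) x‖ ≤ C := fun j => by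
    obtain ⟨B, -, hBφ⟩ := S.exists_bound_of_invariant (hφinv j) (hφc j)
    exact ⟨_, S.norm_R_le h₂.refl hBφ⟩
  -- the factors `u j` (on `T'`) and `v j` (on `T`)
  set u : ℕ → S.T' → ℂ := fun j t' => S.R (refl f₂) (φ j) t' * conj (χ' t') with hu
  set v : ℕ → S.T → ℂ := fun j t => conj (S.R (cj f₁) (φ j) t) * χ t with hv
  have huc : ∀ j, Continuous (u j) := fun j =>
    ((ha'c j).comp continuous_subtype_val).mul (Complex.continuous_conj.comp hχ'.cont)
  have hvc : ∀ j, Continuous (v j) := fun j =>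
    (Complex.continuous_conj.comp ((hac j).comp continuous_subtype_val)).mul hχ.cont
  have hui : ∀ j, Integrable (u j) (S.μT'.restrict S.DT') := fun j => by
    obtain ⟨C, hC⟩ := ha'b j
    refine Integrable.mono' (integrable_const C) (huc j).aestronglyMeasurable
      (Eventually.of_forall fun t' => ?_)
    simp only [hu, norm_mul, RCLike.norm_conj, hχ'.unit, mul_one]
    exact hC _
  have hvi : ∀ j, Integrable (v j) (S.μT.restrict S.DT) := fun j => by
    obtain ⟨C, hC⟩ := hab j
    refine Integrable.mono' (integrable_const C) (hvc j).aestronglyMeasurable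
      (Eventually.of_forall fun t => ?_)
    simp only [hv, norm_mul, RCLike.norm_conj, hχ.unit, mul_one]
    exact hC _
  -- the terms `F j` and the limit `H`
  set F : ℕ → S.T × S.T' → ℂ := fun j z => v j z.1 * u j z.2 with hF
  set H : S.T × S.T' → ℂ := fun z =>
    S.kernel (S.conv f₁ f₂) z.1 z.2 * χ z.1 * conj (χ' z.2) with hH
  -- Step 0a: the term `j` of the statement is `∫ F j dν`
  have hterm : ∀ j, S.periodT' χ' (fun t' => S.R (refl f₂) (φ j) t') *
      conj (S.periodT χ (fun t => S.R (cj f₁) (φ j) t)) = ∫ z, F j z ∂ν := by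
    intro j
    rw [hν, hF]
    rw [integral_prod_mul (v j) (u j)]
    unfold periodT periodT'
    rw [← integral_conj]
    simp only [hu, hv, map_mul, Complex.conj_conj]
    ring
  -- Step 0c: the pointwise expansion
  have hlim : ∀ z, HasSum (fun j => F j z) (H z) := by
    intro z
    have key := (hK z.1 z.2).mul_right (χ z.1 * conj (χ' z.2))
    have e1 : (fun j => S.R (refl f₂) (φ j) z.2 * conj (S.R (cj f₁) (φ j) z.1) *
        (χ z.1 * conj (χ' z.2))) = fun j => F j z := by
      ext j
      simp only [hF, hu, hv]
      ring
    have e2 : S.kernel (S.conv f₁ f₂) z.1 z.2 * (χ z.1 * conj (χ' z.2)) = H z := by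
      simp only [hH]
      ring
    rw [e1, e2] at key
    exact key
  -- the dominating bound
  set bound : ℕ → S.T × S.T' → ℝ := fun j z =>
    2⁻¹ * (‖S.R (refl f₂) (φ j) z.2‖ ^ 2 + ‖S.R (cj f₁) (φ j) z.1‖ ^ 2) with hbound
  have hF_meas : ∀ j, AEStronglyMeasurable (F j) ν := fun j =>
    ((hvc j).aestronglyMeasurable.comp_fst).mul ((huc j).aestronglyMeasurable.comp_snd)
  have hb_pt : ∀ j z, ‖F j z‖ ≤ bound j z := by
    intro j z
    simp only [hF, hu, hv, hbound, norm_mul, RCLike.norm_conj, hχ.unit, hχ'.unit, mul_one]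
    have := two_mul_le_add_sq ‖S.R (refl f₂) (φ j) z.2‖ ‖S.R (cj f₁) (φ j) z.1‖
    linarith
  have h_bound : ∀ j, ∀ᵐ z ∂ν, ‖F j z‖ ≤ bound j z := fun j => Eventually.of_forall (hb_pt j)
  have hsumm : ∀ z : S.T × S.T', Summable fun j => bound j z := fun z =>
    ((S.summable_sq_norm_R h₂.refl hB z.2).add (S.summable_sq_norm_R h₁.cj hB z.1)).mul_left 2⁻¹
  have bound_summable : ∀ᵐ z ∂ν, Summable fun j => bound j z := Eventually.of_forall hsumm
  -- the uniform bound of the tsum on `DT × DT'`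
  obtain ⟨M₁, -, hM₁⟩ := S.exists_bound_tsum_sq_norm_R h₁.cj hB S.isCompact_image_closure_DT
  obtain ⟨M₂, -, hM₂⟩ := S.exists_bound_tsum_sq_norm_R h₂.refl hB S.isCompact_image_closure_DT'
  have htsum_le : ∀ z : S.T × S.T', z.1 ∈ S.DT → z.2 ∈ S.DT' →
      ∑' j, bound j z ≤ 2⁻¹ * (M₂ + M₁) := by
    intro z h1 h2
    have e : ∑' j, bound j z = 2⁻¹ * (∑' j, ‖S.R (refl f₂) (φ j) z.2‖ ^ 2 +
        ∑' j, ‖S.R (cj f₁) (φ j) z.1‖ ^ 2) := by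
      simp only [hbound]
      rw [tsum_mul_left, Summable.tsum_add (S.summable_sq_norm_R h₂.refl hB z.2)
        (S.summable_sq_norm_R h₁.cj hB z.1)]
    rw [e]
    have hz2 : ((z.2 : S.T') : G) ∈ (fun t : S.T' => (t : G)) '' closure S.DT' :=
      ⟨z.2, subset_closure h2, rfl⟩
    have hz1 : ((z.1 : S.T) : G) ∈ (fun t : S.T => (t : G)) '' closure S.DT :=
      ⟨z.1, subset_closure h1, rfl⟩
    have := hM₂ _ hz2
    have := hM₁ _ hz1
    linarith
  have hae_mem : ∀ᵐ z ∂ν, z.1 ∈ S.DT ∧ z.2 ∈ S.DT' := by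
    have h1 : (S.μT.restrict S.DT) S.DTᶜ = 0 := by
      have := ae_restrict_mem₀ (μ := S.μT) S.fdT.nullMeasurableSet
      rw [ae_iff] at this
      exact this
    have h2 : (S.μT'.restrict S.DT') S.DT'ᶜ = 0 := by
      have := ae_restrict_mem₀ (μ := S.μT') S.fdT'.nullMeasurableSet
      rw [ae_iff] at this
      exact this
    rw [ae_iff]
    have hsub : {z : S.T × S.T' | ¬ (z.1 ∈ S.DT ∧ z.2 ∈ S.DT')} ⊆
        S.DTᶜ ×ˢ (Set.univ : Set S.T') ∪ (Set.univ : Set S.T) ×ˢ S.DT'ᶜ := by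
      intro z hz
      simp only [Set.mem_setOf_eq, not_and_or] at hz
      rcases hz with hz | hz
      · exact Or.inl ⟨hz, Set.mem_univ _⟩
      · exact Or.inr ⟨Set.mem_univ _, hz⟩
    refine measure_mono_null hsub (measure_union_null ?_ ?_)
    · rw [hν, Measure.prod_prod, h1, zero_mul]
    · rw [hν, Measure.prod_prod, h2, mul_zero]
  -- measurability of the tsum of the bound (limit of the partial sums)
  have hbound_meas : ∀ j, AEStronglyMeasurable (bound j) ν := fun j => by
    have h2 : AEStronglyMeasurable (fun t' : S.T' => ‖S.R (refl f₂) (φ j) t'‖ ^ 2)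
        (S.μT'.restrict S.DT') :=
      (((ha'c j).comp continuous_subtype_val).norm.pow 2).aestronglyMeasurable
    have h1 : AEStronglyMeasurable (fun t : S.T => ‖S.R (cj f₁) (φ j) t‖ ^ 2)
        (S.μT.restrict S.DT) :=
      (((hac j).comp continuous_subtype_val).norm.pow 2).aestronglyMeasurable
    exact ((h2.comp_snd).add (h1.comp_fst)).const_mul 2⁻¹
  have htsum_meas : AEStronglyMeasurable (fun z => ∑' j, bound j z) ν := by
    refine aestronglyMeasurable_of_tendsto_ae atTop
      (f := fun N z => ∑ j ∈ Finset.range N, bound j z)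
      (fun N => Finset.aestronglyMeasurable_fun_sum _ fun j _ => hbound_meas j) ?_
    exact Eventually.of_forall fun z => (hsumm z).hasSum.tendsto_sum_nat
  have bound_integrable : Integrable (fun z => ∑' j, bound j z) ν := by
    refine Integrable.mono' (integrable_const (2⁻¹ * (M₂ + M₁))) htsum_meas ?_
    filter_upwards [hae_mem] with z hz
    rw [Real.norm_of_nonneg (tsum_nonneg fun j => by positivity)]
    exact htsum_le z hz.1 hz.2
  -- dominated convergence
  have hmain := hasSum_integral_of_dominated_convergence bound hF_meas h_bound bound_summable
    bound_integrable (Eventually.of_forall hlim)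
  -- `∫ H dν = J`
  have hHmeas : AEStronglyMeasurable H ν := by
    refine aestronglyMeasurable_of_tendsto_ae atTop
      (f := fun N z => ∑ j ∈ Finset.range N, F j z)
      (fun N => Finset.aestronglyMeasurable_fun_sum _ fun j _ => hF_meas j) ?_
    exact Eventually.of_forall fun z => (hlim z).tendsto_sum_nat
  have hHint : Integrable H ν := by
    refine Integrable.mono' bound_integrable hHmeas (Eventually.of_forall fun z => ?_)
    rw [← (hlim z).tsum_eq]
    have hs : Summable fun j => ‖F j z‖ :=
      Summable.of_nonneg_of_le (fun j => norm_nonneg _) (fun j => hb_pt j z) (hsumm z)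
    calc ‖∑' j, F j z‖ ≤ ∑' j, ‖F j z‖ := norm_tsum_le_tsum_norm hs
      _ ≤ ∑' j, bound j z := Summable.tsum_le_tsum (fun j => hb_pt j z) hs (hsumm z)
  have hJ : ∫ z, H z ∂ν = S.J χ χ' (S.conv f₁ f₂) := by
    rw [hν, integral_prod H hHint]
    rfl
  -- conclude
  have e : (fun j => S.periodT' χ' (fun t' => S.R (refl f₂) (φ j) t') *
      conj (S.periodT χ (fun t => S.R (cj f₁) (φ j) t))) = fun j => ∫ z, F j z ∂ν :=
    funext hterm
  rw [e, ← hJ]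
  exact hmain

end Setting

end RTF

end Summit.Ventures.HodgeRepro.Tier4.Line1
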